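import Summits.Parity.GeneralizedHardyLittlewood.Theses.ParityWeightedChenSwitching
import Summits.Parity.GeneralizedHardyLittlewood.Theorems.ParityWeightedChenSwitchingParityChenInequalityLower
import Summits.Parity.GeneralizedHardyLittlewood.Theorems.ParityWeightedChenSwitchingParityChenInequalityUpperSum
import Summits.Parity.GeneralizedHardyLittlewood.Theorems.ParityWeightedChenSwitchingParityChenInequalityUpperB
import Summits.Parity.GeneralizedHardyLittlewood.Theorems.ParityWeightedChenSwitchingParityChenInequalitySieve
import Literature.NumberTheory.Sieve.ChenSwitchingConstant
import HarnessLib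

/-!
# Route `ParityWeightedChenSwitching` — crux `ParityChenInequality` (stmt-Parity-18666), PROVED

`Summit.Parity.GeneralizedHardyLittlewood.Theses.ParityWeightedChenSwitching.ParityChenInequality` (S1 of the
route, theorem-grade): there are an absolute `c > 0` and `C` with, for all large `x`,

  `c · x/log²x − C · (E₁(x) + E₂(x)) ≤ π₂(x) = #{p ≤ x : p, p + 2 prime}`,
  `E₁(x) = ∑_{m ≤ x^{0.499}} |∑_{p ≤ x, m ∣ p+2} μ(p + 2)|`, `E₂(x) = ∑_{m ≤ x^{0.499}} |∑_{e ∈ B(x), m ∣ e} μ(e)|`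

(`B(x) = chenSetB x`, Chen's switched set `{p₁p₂p₃ − 2}`), i.e. Chen's twin-form inequality chain
(Nathanson, *Additive Number Theory*, Thms 10.2–10.6) run with the PARITY WEIGHT `u = (1 − μ)/2` on both of
Chen's sieved sequences at the fixed level `0.499`, the Möbius-twisted congruence sums kept as the explicit,
pointwise error `E₁ + E₂` (with `C = 1`). UNCONDITIONAL: every input is a theorem proved in the tree
(Iwaniec's Rosser sieve in twisted form `RosserSieveTwisted`, Bombieri–Vinogradov
`BombieriVinogradovStatement_holds`, the switched-set bounds `chenTriplesExt_card_bound` /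
`chenRemainderExt_bound`, PNT and Mertens), assembled in the five support files
`ParityWeightedChenSwitchingParityChenInequality{Tools,PrimeSum,Lower,UpperSum,UpperB,Sieve}` — the five
registered stubs of the crux's birth skeleton `Cruxes/ParityChenInequality/Lines/birth.lean`, unfolded — and
composed here exactly as the skeleton's kernel-checked `ParityChenInequality_of` (`ε = κ/4`, `c = 4κe⁻⁷`,
`C = 1`). The numerical margin `κ = A₁ − A₂/2 − A₃/2 > 0` (`stub_numerics`) reduces, because
`(1/8)/(0.499 − 1/8) = 1/2.992` identically, to `c_sw < log(2.992 · 0.497) = log 1.487024 = 0.3967…`, certified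
from the tree's rational majorant of the switching integral (`switchingIntegrand_le`,
`integral_switchingMajorant`: `c_sw ≤ 0.37166`) and `artanh`-series bounds for `log(3/2)`, `log(7/4)`,
`log 1.487024` (`Real.sum_range_le_log_div`).

References: [ChenSciSinica1973]; [Nathanson1996] Ch. 10; [IwaniecActaArith1980]; [Harman2007] §14.2
(the twisted sum `∑_d |∑_{dn = p+2} μ(n)|` as the missing input for twins).
-/

namespace Summit.Parity.GeneralizedHardyLittlewood.Theorems

open Finset Filter Topology
open scoped ArithmeticFunction.Moebius ArithmeticFunction.Omega
open Literature.NumberTheory.Sieve Literature.NumberTheory.Sieve.Chen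
  Literature.NumberTheory.Sieve.ChenSieve

/-! ### The numerical margin (`stub_numerics`) -/

/-- `log(3/2) > 0.405464` (four terms of the `artanh` series at `1/5`). -/
theorem log_three_halves_gt_d6 : (0.405464 : ℝ) < Real.log (3 / 2) := by
  have h := Real.sum_range_le_log_div (x := 1 / 5) (by norm_num) (by norm_num) 4
  norm_num [Finset.sum_range_succ] at h
  linarith

/-- `log(7/4) > 0.559615` (five terms of the `artanh` series at `3/11`). -/
theorem log_seven_fourths_gt_d6 : (0.559615 : ℝ) < Real.log (7 / 4) := by
  have h := Real.sum_range_le_log_div (x := 3 / 11) (by norm_num) (by norm_num) 5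
  norm_num [Finset.sum_range_succ] at h
  linarith

/-- `log 1.487024 > 0.3966` (two terms of the `artanh` series at `30439/155439`). -/
theorem log_1487024_gt : (0.3966 : ℝ) < Real.log (1487024 / 1000000) := by
  have h := Real.sum_range_le_log_div (x := 30439 / 155439) (by norm_num) (by norm_num) 2
  norm_num [Finset.sum_range_succ] at h
  linarith

/-- **The switching constant is below `log 1.487024`**: `c_sw ≤ 495/1152 + 15/16 + (5/6)log(8/3) −
(20/3)log(21/16) < 0.3717 < 0.3966 < log 1.487024` (the tree's majorant `switchingIntegrand_le`,
`integral_switchingMajorant`, and the `log` bounds above with Mathlib's `log 2`). -/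
theorem switchingConstant_lt_log : switchingConstant < Real.log (1487024 / 1000000) := by
  have hmono : switchingConstant ≤
      ∫ β in (1 / 8 : ℝ)..(1 / 3), (9 * β + 9 / 2 + 5 / 6 / β - 20 / 3 / (1 - β)) :=
    intervalIntegral.integral_mono_on (by norm_num)
      (continuousOn_switchingIntegrand.intervalIntegrable_of_Icc (by norm_num))
      (continuousOn_switchingMajorant.intervalIntegrable_of_Icc (by norm_num))
      (fun β hβ => switchingIntegrand_le hβ.1 hβ.2)
  rw [integral_switchingMajorant] at hmono
  have h83 : Real.log (8 / 3) = 3 * Real.log 2 - Real.log 3 := by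
    rw [Real.log_div (by norm_num) (by norm_num), show (8 : ℝ) = 2 ^ 3 by norm_num, Real.log_pow]
    norm_num
  have h2116 : Real.log (21 / 16) = Real.log 3 + Real.log 7 - 4 * Real.log 2 := by
    rw [Real.log_div (by norm_num) (by norm_num), show (21 : ℝ) = 3 * 7 by norm_num,
      Real.log_mul (by norm_num) (by norm_num), show (16 : ℝ) = 2 ^ 4 by norm_num, Real.log_pow]
    norm_num
  have h32 : Real.log (3 / 2) = Real.log 3 - Real.log 2 := Real.log_div (by norm_num) (by norm_num)
  have h74 : Real.log (7 / 4) = Real.log 7 - 2 * Real.log 2 := by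
    rw [Real.log_div (by norm_num) (by norm_num), show (4 : ℝ) = 2 ^ 2 by norm_num, Real.log_pow]
    norm_num
  have hl2 := Real.log_two_lt_d9
  have hl2' := Real.log_two_gt_d9
  have hl32 := log_three_halves_gt_d6
  have hl74 := log_seven_fourths_gt_d6
  have hlog := log_1487024_gt
  rw [h32] at hl32
  rw [h74] at hl74
  rw [h83, h2116] at hmono
  linarith

/-- **`stub_numerics`** (verbatim the registered signature): the margin
`κ = A₁ − A₂/2 − A₃/2 = e^γ(log(2.992)/3.992 − Λ/16 − c_sw/(8·0.998)) > 0`,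
`Λ = (log((1/3)/(0.499−1/3)) − log((1/8)/(0.499−1/8)))/0.499`. Since `(1/8)/(0.499 − 1/8) = 1/2.992` and
`(1/3)/(0.499 − 1/3) = 1000/497`, `κ = (e^γ/7.984)(log 2.992 − log(1000/497) − c_sw)
= (e^γ/7.984)(log 1.487024 − c_sw) > 0` by `switchingConstant_lt_log`. -/
theorem parityChen_numerics :
    0 < Real.exp Real.eulerMascheroniConstant * (Real.log 2.992 / 3.992) -
      (Real.exp Real.eulerMascheroniConstant *
        ((Real.log ((1 / 3) / (0.499 - 1 / 3)) - Real.log ((1 / 8) / (0.499 - 1 / 8))) / 0.499) / 8) / 2 -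
      (switchingConstant * Real.exp Real.eulerMascheroniConstant / (4 * 0.998)) / 2 := by
  set G := Real.exp Real.eulerMascheroniConstant with hG
  have hG0 : 0 < G := Real.exp_pos _
  have e1 : Real.log ((1 / 8 : ℝ) / (0.499 - 1 / 8)) = -Real.log 2.992 := by
    rw [show (1 / 8 : ℝ) / (0.499 - 1 / 8) = (2.992 : ℝ)⁻¹ by norm_num, Real.log_inv]
  have e2 : Real.log ((1 / 3 : ℝ) / (0.499 - 1 / 3)) = Real.log (1000 / 497) := by
    rw [show (1 / 3 : ℝ) / (0.499 - 1 / 3) = 1000 / 497 by norm_num]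
  have e3 : Real.log 2.992 - Real.log (1000 / 497) = Real.log (1487024 / 1000000) := by
    rw [← Real.log_div (by norm_num) (by norm_num)]
    norm_num
  rw [e1, e2]
  set ℓ₁ := Real.log (2.992 : ℝ) with hℓ₁
  set ℓ₂ := Real.log ((1000 : ℝ) / 497) with hℓ₂
  set c := switchingConstant with hc
  have hkey : G * (ℓ₁ / 3.992) - (G * ((ℓ₂ - (-ℓ₁)) / 0.499) / 8) / 2 - (c * G / (4 * 0.998)) / 2 =
      G / 7.984 * (ℓ₁ - ℓ₂ - c) := by
    ring
  rw [hkey]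
  have hpos : 0 < ℓ₁ - ℓ₂ - c := by
    rw [e3]
    linarith [switchingConstant_lt_log]
  positivity

/-! ### The crux -/

set_option maxHeartbeats 400000 in
/-- **S1 = `ParityChenInequality`, PROVED (unconditionally).** There are `c > 0` and `C` (here
`c = 4κe⁻⁷`, `C = 1`) such that for all large `x`,
`c·x/log²x − C·(∑_{m ≤ x^{0.499}} |∑_{p ≤ x, m ∣ p+2} μ(p+2)| + ∑_{m ≤ x^{0.499}} |∑_{e ∈ B(x), m ∣ e} μ(e)|)
  ≤ #{p ≤ x : p, p + 2 prime}`.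
Proof (Nathanson §10.8 with halved constants; verbatim the registered skeleton's `ParityChenInequality_of`):
with `κ = A₁ − A₂/2 − A₃/2 > 0` (`parityChen_numerics`) and `ε = κ/4` in the three sieve estimates
`parityMoebius_twin_sieveLower` (A)ᵘ, `parityMoebius_twin_sieveUpperSum` (B)ᵘ, `parityMoebius_twin_sieveUpperB`
(C)ᵘ, the weighted-sieve inequality `parityMoebius_chenWeighted` gives
`π₂ ≥ (κ/2)·XV − ¾E₁ − ¼E₂ − y/2 − 2(x+2)/(z−1)`; `XV ≥ 16e⁻⁷x/log²x` (`twinMainTerm_ge`) and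
`y/2 + 2(x+2)/(z−1) ≤ 12x^{7/8} ≤ 4κe⁻⁷x/log²x` (`twin_errorTerms_le`, `eventually_twin_errorTerms_le`). -/
theorem parityChenInequality_proof :
    Summit.Parity.GeneralizedHardyLittlewood.Theses.ParityWeightedChenSwitching.ParityChenInequality := by
  have h1 := parityMoebius_chenWeighted
  have h2 := parityMoebius_twin_sieveLower
  have h3 := parityMoebius_twin_sieveUpperSum
  have h4 := parityMoebius_twin_sieveUpperB
  have h5 := parityChen_numerics
  -- the three sieve constants and the margin
  set A₁ : ℝ := Real.exp Real.eulerMascheroniConstant * (Real.log 2.992 / 3.992) with hA₁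
  set A₂ : ℝ := Real.exp Real.eulerMascheroniConstant *
      ((Real.log ((1 / 3) / (0.499 - 1 / 3)) - Real.log ((1 / 8) / (0.499 - 1 / 8))) / 0.499) / 8 with hA₂
  set A₃ : ℝ := switchingConstant * Real.exp Real.eulerMascheroniConstant / (4 * 0.998) with hA₃
  set κ : ℝ := A₁ - A₂ / 2 - A₃ / 2 with hκ
  have hκpos : 0 < κ := h5
  have hε : 0 < κ / 4 := by positivity
  refine ⟨4 * κ * Real.exp (-7), by positivity, 1, ?_⟩
  filter_upwards [h2 _ hε, h3 _ hε, h4 _ hε, eventually_ge_atTop 6561,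
    eventually_twin_errorTerms_le (show 0 < 2 * κ * Real.exp (-7) by positivity)] with x hAx hBx hCx hx hjunk
  have hW := h1 x (by omega)
  have hM := twinMainTerm_ge hx
  have hJ := twin_errorTerms_le (show 256 ≤ x by omega)
  -- names for the sums
  set E1 := ∑ m ∈ Finset.Icc 1 ⌊(x : ℝ) ^ (0.499 : ℝ)⌋₊,
    |∑ p ∈ (Nat.primesLE x).filter (fun p => m ∣ p + 2), (ArithmeticFunction.moebius (p + 2) : ℝ)| with hE1
  set E2 := ∑ m ∈ Finset.Icc 1 ⌊(x : ℝ) ^ (0.499 : ℝ)⌋₊,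
    |∑ e ∈ (Literature.NumberTheory.Sieve.Chen.chenSetB x).filter (fun e => m ∣ e),
      (ArithmeticFunction.moebius e : ℝ)| with hE2
  set Φ₁ := ∑ n ∈ (twinSieveSet x).filter (fun n => IsRough (twinZ x) n), (1 - (μ n : ℝ)) / 2 with hΦ₁
  set Φ₂ := ∑ q ∈ primesIco (twinZ x) (twinY x),
    ∑ n ∈ (twinSieveSet x).filter (fun n => q ∣ n ∧ IsRough (twinZ x) n), (1 - (μ n : ℝ)) / 2 with hΦ₂
  set Φ₃ := ∑ e ∈ (chenSetB x).filter (fun e => IsRough (twinY x) e), (1 - (μ e : ℝ)) / 2 with hΦ₃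
  have hE1n : 0 ≤ E1 := Finset.sum_nonneg fun _ _ => abs_nonneg _
  have hE2n : 0 ≤ E2 := Finset.sum_nonneg fun _ _ => abs_nonneg _
  have hy : (0 : ℝ) ≤ (twinY x : ℝ) / 2 := by positivity
  -- the main-term identity: `(A₁ − ε) − ½(A₂ + ε) − ½(A₃ + ε) = κ/2` at `ε = κ/4`
  have hkey : (A₁ - κ / 4) * twinMainTerm x - (A₂ + κ / 4) * twinMainTerm x / 2 -
      (A₃ + κ / 4) * twinMainTerm x / 2 = κ / 2 * twinMainTerm x := by
    rw [hκ]; ring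
  -- `linarith` treats a quotient by a non-numeral as an atom: isolate `L = x/(log x)²`
  set L := (x : ℝ) / Real.log x ^ 2 with hL
  have hM' : 16 * Real.exp (-7) * L ≤ twinMainTerm x := by
    rw [hL, show 16 * Real.exp (-7) * ((x : ℝ) / Real.log x ^ 2) =
      16 * Real.exp (-7) * x / Real.log x ^ 2 by ring]
    exact hM
  have hjunk' : 6 * (x : ℝ) ^ (7 / 8 : ℝ) ≤ 2 * κ * Real.exp (-7) * L := by
    rw [hL, show 2 * κ * Real.exp (-7) * ((x : ℝ) / Real.log x ^ 2) =
      2 * κ * Real.exp (-7) * x / Real.log x ^ 2 by ring]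
    exact hjunk
  rw [show 4 * κ * Real.exp (-7) * (x : ℝ) / Real.log x ^ 2 = 4 * κ * Real.exp (-7) * L by
    rw [hL]; ring]
  have hmain : 8 * κ * Real.exp (-7) * L ≤ κ / 2 * twinMainTerm x :=
    calc 8 * κ * Real.exp (-7) * L = κ / 2 * (16 * Real.exp (-7) * L) := by ring
      _ ≤ κ / 2 * twinMainTerm x := mul_le_mul_of_nonneg_left hM' (by positivity)
  -- junk: `y/2 + 2(x+2)/(z−1) ≤ 2·(y/2 + (x+2)/(z−1)) ≤ 12 x^{7/8} ≤ 4κe⁻⁷ L`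
  have hJ2 : (twinY x : ℝ) / 2 + 2 * (((x : ℝ) + 2) / ((twinZ x : ℝ) - 1)) ≤ 4 * κ * Real.exp (-7) * L := by
    have hz : (2 : ℝ) ≤ (twinZ x : ℝ) := by exact_mod_cast two_le_twinZ (show 2 ≤ x by omega)
    have hq : 0 ≤ ((x : ℝ) + 2) / ((twinZ x : ℝ) - 1) := div_nonneg (by positivity) (by linarith)
    linarith
  linarith

end Summit.Parity.GeneralizedHardyLittlewood.Theorems
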